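import Mathlib
import HarnessLib
import Literature.Barriers.CriticalPhenomena.SAWNoUnitaryCFT

/-!
# κ-calibration of the crux `MassRatio` (stmt-CriticalPhenomena-8550) — crux-strategist s1, STRATEGY-CENSUS §1/§5

Kernel-checked Coulomb-gas ARITHMETIC (predictions, not theorems about SAW) used by the strategy
census of this crux. Along the dilute `O(n)` line (`n = -2cos(4π/κ)`, `2 ≤ κ ≤ 4`, Coulomb-gas
coupling `g = 4/κ`) the boundary one-leg weight is the SLE boundary weight
`h_b = h_{1,2} = (6-κ)/(2κ)` (`UnitaryCFT.sleBoundaryWeight`) and the bulk one-leg dimension is the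
watermelon exponent `x₁ = g/8 - (g-1)²/(2g)` (`UnitaryCFT.legExponent g 1`). The crux compares the
`δ²`-normalised boundary-to-bulk mass (`≍ δ^{h_b + x₁}`) with the boundary-to-boundary mass
(`≍ δ^{2h_b}`) at the exponent cut `3/4`; its predicted truth value along the line is therefore the
sign of `3/4 - (h_b - x₁)`, and

* `ratioExponent_eq` : `h_b - x₁ = (6-κ)²/(8κ)`;
* values: `25/48` at `κ = 8/3` (SAW), `3/8` at `κ = 3` (Ising), `1/8` at `κ = 4`, and `1` at `κ = 2`
  (the `O(-2)` / loop-erased-walk point, where the masses are simple-random-walk Green kernels and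
  the crux's inequality at cut `3/4` is FALSE);
* `ratioExponent_le_iff` : for `κ > 0`, `h_b - x₁ ≤ c ↔ κ² - (12 + 8c)κ + 36 ≤ 0`; at `c = 3/4` the
  threshold (smaller root) is `κ* = 9 - 3√5 ∈ (2.29, 2.30)` (`threshold_root`, `threshold_window`),
  at `c = 1` it is exactly `κ = 2` (`ratioExponent_le_one_iff`).

So the filed crux is a statement that is true for the SAW class `κ = 8/3` and false for every member
of the same one-parameter family with `κ < 9 - 3√5`; any proof must be sensitive to `κ` at resolution
`8/3 - κ* ≈ 0.375`, i.e. must extract from self-avoidance a power gain over the random-walk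
(`κ = 2`) values of the two exponents. Sources: Cardy, "SLE for theoretical physicists" (2005) §2.4.2,
§5.3; Duplantier–Saleur, Phys. Rev. Lett. 57 (1986) 3179 (watermelon exponents); Nienhuis (1982).
-/

noncomputable section

namespace Summit.CriticalPhenomena.SAWScalingLimit.Cruxes.MassRatio.KappaCalibration

open Literature.Barriers.CriticalPhenomena.UnitaryCFT

/-- Predicted exponent of the crux's mass ratio along the dilute `O(n)` line:
`h_b - x₁ = h_{1,2}(κ) - x₁(g = 4/κ)`. [cite: Cardy2005SLE, §2.4.2 and §5.3] -/
def ratioExponent (κ : ℝ) : ℝ := sleBoundaryWeight κ - legExponent (4 / κ) 1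

/-- Predicted exponent of the `δ²`-normalised boundary-to-bulk mass: `h_b + x₁`.
[cite: Cardy2005SLE, §2.4.2 and §5.3] -/
def bulkExponent (κ : ℝ) : ℝ := sleBoundaryWeight κ + legExponent (4 / κ) 1

/-- Predicted exponent of the boundary-to-boundary mass: `2h_b`. [cite: Cardy2005SLE, §5.3] -/
def boundaryExponent (κ : ℝ) : ℝ := 2 * sleBoundaryWeight κ

/-- `h_b - x₁ = (6-κ)²/(8κ)`. [folklore] -/
theorem ratioExponent_eq {κ : ℝ} (hκ : κ ≠ 0) : ratioExponent κ = (6 - κ) ^ 2 / (8 * κ) := by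
  unfold ratioExponent sleBoundaryWeight legExponent
  push_cast
  field_simp
  ring

/-- `h_b + x₁ = (6-κ)(κ+2)/(8κ)`. [folklore] -/
theorem bulkExponent_eq {κ : ℝ} (hκ : κ ≠ 0) : bulkExponent κ = (6 - κ) * (κ + 2) / (8 * κ) := by
  unfold bulkExponent sleBoundaryWeight legExponent
  push_cast
  field_simp
  ring

/-- `2h_b = (6-κ)/κ`. [folklore] -/
theorem boundaryExponent_eq {κ : ℝ} (hκ : κ ≠ 0) : boundaryExponent κ = (6 - κ) / κ := by
  unfold boundaryExponent sleBoundaryWeight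
  field_simp

/-- The ratio exponent is the difference `2h_b - (h_b + x₁)`. [folklore] -/
theorem ratioExponent_eq_sub (κ : ℝ) : ratioExponent κ = boundaryExponent κ - bulkExponent κ := by
  unfold ratioExponent boundaryExponent bulkExponent
  ring

/-- SAW (`κ = 8/3`): ratio `25/48`, bulk `35/48`, boundary `5/4 = 60/48`. [folklore] -/
theorem values_saw :
    ratioExponent (8 / 3) = 25 / 48 ∧ bulkExponent (8 / 3) = 35 / 48 ∧
      boundaryExponent (8 / 3) = 5 / 4 := by
  refine ⟨?_, ?_, ?_⟩
  · rw [ratioExponent_eq (by norm_num)]; norm_num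
  · rw [bulkExponent_eq (by norm_num)]; norm_num
  · rw [boundaryExponent_eq (by norm_num)]; norm_num

/-- Ising (`κ = 3`): ratio `3/8` (boundary spin `1/2`, bulk spin `1/8`). [folklore] -/
theorem values_ising :
    ratioExponent 3 = 3 / 8 ∧ bulkExponent 3 = 5 / 8 ∧ boundaryExponent 3 = 1 := by
  refine ⟨?_, ?_, ?_⟩
  · rw [ratioExponent_eq (by norm_num)]; norm_num
  · rw [bulkExponent_eq (by norm_num)]; norm_num
  · rw [boundaryExponent_eq (by norm_num)]; norm_num

/-- `κ = 4` (`n = 2`): ratio `1/8`. [folklore] -/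
theorem values_four : ratioExponent 4 = 1 / 8 := by
  rw [ratioExponent_eq (by norm_num)]; norm_num

/-- `κ = 2` (`O(-2)` / loop-erased walk; simple-random-walk Green kernels): ratio `1`, bulk `1`,
boundary `2` — the random-walk values `h_b = 1`, `x₁ = 0`. [folklore] -/
theorem values_lerw :
    ratioExponent 2 = 1 ∧ bulkExponent 2 = 1 ∧ boundaryExponent 2 = 2 ∧
      sleBoundaryWeight 2 = 1 ∧ legExponent (4 / 2) 1 = 0 := by
  refine ⟨?_, ?_, ?_, ?_, ?_⟩
  · rw [ratioExponent_eq (by norm_num)]; norm_num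
  · rw [bulkExponent_eq (by norm_num)]; norm_num
  · rw [boundaryExponent_eq (by norm_num)]; norm_num
  · norm_num [sleBoundaryWeight]
  · norm_num [legExponent]

/-- The cut inequality as a quadratic in `κ`: for `κ > 0`,
`h_b - x₁ ≤ c ↔ κ² - (12 + 8c)κ + 36 ≤ 0`. [folklore] -/
theorem ratioExponent_le_iff {κ : ℝ} (hκ : 0 < κ) (c : ℝ) :
    ratioExponent κ ≤ c ↔ κ ^ 2 - (12 + 8 * c) * κ + 36 ≤ 0 := by
  rw [ratioExponent_eq hκ.ne', div_le_iff₀ (by positivity)]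
  constructor <;> intro h <;> nlinarith [h]

/-- At the route's cut `c = 3/4`: `h_b - x₁ ≤ 3/4 ↔ κ² - 18κ + 36 ≤ 0` (`κ > 0`). [folklore] -/
theorem ratioExponent_le_threeQuarters_iff {κ : ℝ} (hκ : 0 < κ) :
    ratioExponent κ ≤ 3 / 4 ↔ κ ^ 2 - 18 * κ + 36 ≤ 0 := by
  rw [ratioExponent_le_iff hκ]; constructor <;> intro h <;> linarith

/-- The threshold `κ* = 9 - 3√5` is a root of `κ² - 18κ + 36`. [folklore] -/
theorem threshold_root : (9 - 3 * Real.sqrt 5) ^ 2 - 18 * (9 - 3 * Real.sqrt 5) + 36 = 0 := by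
  have h5 : Real.sqrt 5 ^ 2 = 5 := Real.sq_sqrt (by norm_num)
  nlinarith [h5]

/-- Numerical window for the threshold: `κ* ∈ (2.29, 2.30)`; the crux's inequality (in truth)
FAILS at `κ = 2.29` and HOLDS at `κ = 2.30`, holds at `κ = 8/3` with margin `11/48`, and fails at
`κ = 2` by `1/4`. [folklore] -/
theorem threshold_window :
    3 / 4 < ratioExponent (229 / 100) ∧ ratioExponent (23 / 10) < 3 / 4 ∧
      3 / 4 - ratioExponent (8 / 3) = 11 / 48 ∧ ratioExponent 2 - 3 / 4 = 1 / 4 := by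
  refine ⟨?_, ?_, ?_, ?_⟩
  · rw [ratioExponent_eq (by norm_num)]; norm_num
  · rw [ratioExponent_eq (by norm_num)]; norm_num
  · rw [ratioExponent_eq (by norm_num)]; norm_num
  · rw [ratioExponent_eq (by norm_num)]; norm_num

/-- At cut `1` the threshold is exactly the random-walk point: for `κ > 0`,
`h_b - x₁ ≤ 1 ↔ (κ - 2)(κ - 18) ≤ 0`. [folklore] -/
theorem ratioExponent_le_one_iff {κ : ℝ} (hκ : 0 < κ) :
    ratioExponent κ ≤ 1 ↔ (κ - 2) * (κ - 18) ≤ 0 := by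
  rw [ratioExponent_le_iff hκ]; constructor <;> intro h <;> nlinarith [h]

/-- THE DOUBLE WALL (census §1), arithmetic half. Write a one-sided decomposition of the crux at
cut `c` as a certified bulk exponent `p` (bulk mass `≤ δ^{p}`, so necessarily `p ≤ p_truth`) and a
certified boundary exponent `q` (boundary mass `≥ δ^{q}`, so necessarily `q_truth ≤ q`) with
`q - p ≤ c`. With the SAW truths `p_truth = 35/48`, `q_truth = 60/48` and the random-walk values
`p_RW = 1`, `q_RW = 2`: at `c = 3/4` every such pair has `q ≤ 71/48 < 2 = q_RW` (the boundary side
must beat the random-walk exponent by at least `25/48`) and `p ≥ 24/48 > 0` (the bulk side must be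
a DECAY bound, where no polynomial bound of either sign is known). [folklore] -/
theorem double_wall (p q : ℝ) (hp : p ≤ 35 / 48) (hq : 60 / 48 ≤ q) (hc : q - p ≤ 3 / 4) :
    q ≤ 71 / 48 ∧ 2 - q ≥ 25 / 48 ∧ 24 / 48 ≤ p ∧ 0 < p := by
  refine ⟨by linarith, by linarith, by linarith, by linarith⟩

/-- The same wall in the arc-summed (`FlatRoot`) normalisation of the landed split
`MassRatio_of_subs` (`HalfDiscArcArrival B ∧ ArcRootedBulkMass A`, `A + B < 3/4`; truths
`A = 13/48`, `B = 12/48`; random-walk values `A_RW = 0`, `B_RW = 1`): every admissible pair has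
`B < 23/48` (below the random-walk value by more than `25/48`) and `A < 1/2`, and the children's
margins sum to less than the parent's `11/48`. [folklore] -/
theorem double_wall_arc (A B : ℝ) (hA : 13 / 48 ≤ A) (hB : 12 / 48 ≤ B) (hc : A + B < 3 / 4) :
    B < 23 / 48 ∧ 1 - B > 25 / 48 ∧ A < 1 / 2 ∧ (A - 13 / 48) + (B - 12 / 48) < 11 / 48 := by
  refine ⟨by linarith, by linarith, by linarith, by linarith⟩

end Summit.CriticalPhenomena.SAWScalingLimit.Cruxes.MassRatio.KappaCalibration
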